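import Summits.CriticalPhenomena.PercolationContinuityZ3.Theorems.PercAnnulusCrossingIICNearPoint
import Summits.CriticalPhenomena.PercolationContinuityZ3.Theorems.PercAnnulusCrossingIICTwoPointCU
import Summits.CriticalPhenomena.PercolationContinuityZ3.Theorems.PercAnnulusCrossingIICSpanningTree
import Summits.CriticalPhenomena.PercolationContinuityZ3.Theorems.PercAnnulusCrossingIICOneArmBallSum
import Summits.CriticalPhenomena.PercolationContinuityZ3.Theorems.PercNearOneGluingNoHeavyRsw3VolumeSecondMoment
import Summits.CriticalPhenomena.PercolationContinuityZ3.Theorems.PercNearOneGluingNoHeavyRsw3VolumeLargestCluster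
import HarnessLib

/-!
# The mass of Kesten's IIC in a far ball it visits: conditional mean `≍ m^d π(m)`, second moment, tightness (lane RSW3, p1 gen 23)

builds on p205010 (kernel theorem, internal audit signed; external expert review pending) — USED only through the tree formula of
`…IICSpanningTree` (exact re-rooting, `θ(p_c) = 0`) in the second-moment bound; the first-moment statements only need `p_c(ℤ^d) > 0`.

RSW3 lane (LANE 3 `prim-rsw3`), seat `prim-rsw3-p1` (gen 23).  Helper file (`--supports stmt-CriticalPhenomena-4575`); no definitions,
no sorries.  Memo `run/shared/lean/prim/rsw3/P1-QM.md` §36.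

Fix a far site `x` and a radius `m`, and let `V = #(C(0) ∩ Λ_x(m)) = #{y ∈ x + Λ(m) : 0 ↔ y}` be the number of IIC sites in the ball
`Λ_x(m)`, `hit = {V > 0} = {dist_∞(x, C(0)) ≤ m}`, `M = (2m+1)^d = |Λ(m)|`.  Gen 22 gave the law of the distance `π(m)·ν(hit) ≍ π(‖x‖)`
(`…IICNearPoint`) and the mean `E_ν[V] = Σ_{y ∈ Λ_x(m)} ν(0 ↔ y) ≍ M·π(‖x‖)` (`…IICTwoPointCU`).  Here:

* **`exists_iicMeasure_sum_ball_real_openConn_two_sided_hit_criticalProbI`** — THE CONDITIONAL MEAN: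
  **`c·M·π_{p_c}(m)·ν(hit) ≤ E_ν[V] ≤ C·M·π_{p_c}(m)·ν(hit)`** (`m ≥ 1`, `l(m+2) ≤ ‖x‖`, `‖x‖ ≥ n₀`), i.e. **`E_ν[V | hit] ≍ m^d·π_{p_c}(m)`** —
  given that the IIC comes within distance `m` of `x`, its mean mass there is the mean mass `≍ m^d π(m)` of an IIC ball of radius `m`;
* **`exists_iicMeasure_sum_ball_sum_ball_real_openConn_inter_le_criticalProbI`** — THE SECOND MOMENT NEAR A FAR POINT:
  **`E_ν[V²] = Σ_{y, y' ∈ Λ_x(m)} ν(0 ↔ y, 0 ↔ y') ≤ C·M²·π_{p_c}(m)·π_{p_c}(‖x‖)`** (`4m ≤ ‖x‖`, `‖x‖ ≥ n₀`): the threshold-free pair bound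
  `ν(0 ↔ y, 0 ↔ y') ≤ C²·π(‖y‖)·π(‖y − y'‖)` of `…IICSpanningTree` along the nearest-parent insertion `0, y, y'`, the ratio bound
  `π(‖y‖) ≤ B·π(‖x‖)`, the one-arm ball sum `Σ_{w ∈ Λ(2m)} π(‖w‖) ≤ C_b·(2m)^d·π(2m)` (`…IICOneArmBallSum`) and the BK floor `c₁ ≤ M·π(m)`;
* `exists_iicMeasure_real_card_ball_ge_le_criticalProbI` — Markov (`Rsw3.mul_real_le_card_filter_le_sum`): **`K·π_{p_c}(m)·ν(V ≥ K·M·π_{p_c}(m)) ≤ C·π_{p_c}(‖x‖)`**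
  for every `K ≥ 0` (`2m ≤ ‖x‖`, `‖x‖ ≥ n₀`): given the hit, `V/(M·π(m))` is tight.
The matching lower bound in probability (Paley–Zygmund: given the hit, `V ≥ λ·M·π(m)` with conditional probability `≥ c`) is in
`PercAnnulusCrossingIICFatWhereItPasses.lean`.  All at `p_c(ℤ^d)`, `d ≥ 2`, under (A2)□(s,L) + `CU⁺_l`, for IIC probability measures `ν`
(Kesten's limit property), constants uniform in `ν, x, m`.
References: H. Kesten, PTRF 73 (1986) Thm. (8); D. Basu, A. Sapozhnikov, ECP 22 (2017) Thm. 1.1; G. Grimmett, *Percolation* (1999) §11.7.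
-/

noncomputable section

namespace Summit.CriticalPhenomena.PercolationContinuityZ3.Theorems.Crossing

open MeasureTheory Filter Topology Literature.Probability.Percolation Literature.Probability.LatticeModels
open Literature.Probability.Percolation.DCT16
open Summit.CriticalPhenomena.PercolationContinuityZ3.Theorems.SurfaceTension

variable {d : ℕ}

/-! ## §1 The conditional mean mass near a far point given a hit -/

open Classical in
/-- **THE MEAN MASS OF THE IIC IN A FAR BALL, GIVEN THAT IT VISITS THE BALL, IS `≍ m^d π(m)`** (`p_c(ℤ^d)`, `d ≥ 2`; (A2)□ at aspect
`(s,L)`, `2 ≤ s ≤ L`, `ϰ > 0`; `CU⁺_l(c_U)`, `l ≥ 2`, `c_U > 0`): there are `n₀ ≥ 1` and `0 < c, C` such that for every IIC probability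
measure `ν`, every `m ≥ 1` and every `x` with `l(m+2) ≤ ‖x‖_∞` and `n₀ ≤ ‖x‖_∞`, writing `hit = {∃ q ∈ Λ_x(m), 0 ↔ q}` and `M = (2m+1)^d`:
**`c·M·π_{p_c}(m)·ν(hit) ≤ Σ_{y ∈ Λ_x(m)} ν(0 ↔ y) ≤ C·M·π_{p_c}(m)·ν(hit)`** — `E_ν[#(C(0) ∩ Λ_x(m)) | hit] ≍ m^d·π(m)`, the mean volume
of an IIC ball of radius `m` (`…IICNearPoint`: `π(m)ν(hit) ≍ π(‖x‖)`; `…IICTwoPointCU`: `Σ ≍ M·π(‖x‖)`). [cite: Kesten1986, Thm. (8)] -/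
theorem exists_iicMeasure_sum_ball_real_openConn_two_sided_hit_criticalProbI (hd : 2 ≤ d) {s L : ℕ} (hs : 2 ≤ s) (hsL : s ≤ L)
    {ϰ : ℝ} (hϰ : 0 < ϰ) (hA2 : SetToSetQuasiMultAspectAt d (criticalProbI d) s L ϰ) {l : ℕ} (hl : 2 ≤ l) {cU : ℝ} (hcU : 0 < cU)
    (hCU : ∀ a : ℕ, 1 ≤ a → ∀ E : Set (BondConfig (Site d)), IsUpperSet E → MeasurableSet E →
      cU * (bondPercolation (zdGraph d) (criticalProbI d)).real E ≤ (bondPercolation (zdGraph d) (criticalProbI d)).real (E ∩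
        {ω : BondConfig (Site d) | ∀ t ∈ innerBoundary (zdGraph d) (box d a), ∀ s ∈ innerBoundary (zdGraph d) (box d (l * a)),
          ∀ t' ∈ innerBoundary (zdGraph d) (box d a), ∀ s' ∈ innerBoundary (zdGraph d) (box d (l * a)),
          ω ∈ openConnIn (↑((box d (l * a) \ box d a) ∪ innerBoundary (zdGraph d) (box d a)) : Set (Site d)) t s →
          ω ∈ openConnIn (↑((box d (l * a) \ box d a) ∪ innerBoundary (zdGraph d) (box d a)) : Set (Site d)) t' s' →
          ω ∈ openConnIn (↑((box d (l * a) \ box d a) ∪ innerBoundary (zdGraph d) (box d a)) : Set (Site d)) s s'})) :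
    ∃ (n₀ : ℕ) (c C : ℝ), 1 ≤ n₀ ∧ 0 < c ∧ 0 < C ∧ ∀ (ν : Measure (BondConfig (Site d))) [IsProbabilityMeasure ν],
      (∀ (F : Finset (Sym2 (Site d))) (E : Set (BondConfig (Site d))), MeasurableSet E → DeterminedBy E ↑F →
        Tendsto (fun n : ℕ => (bondPercolation (zdGraph d) (criticalProbI d)).real (E ∩ siteToBoundary d n) /
          oneArmProb d (criticalProbI d) n) atTop (𝓝 (ν.real E))) →
      ∀ (m : ℕ) (x : Site d), 1 ≤ m → l * (m + 2) ≤ Site.supNorm x → n₀ ≤ Site.supNorm x →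
        c * ((2 * m + 1 : ℕ) : ℝ) ^ d * oneArmProb d (criticalProbI d) m *
              ν.real {ω | ∃ q ∈ (box d m).image (· + x), ω ∈ (openConn (0 : Site d) q : Set (BondConfig (Site d)))} ≤
            ∑ y ∈ (box d m).image (· + x), ν.real (openConn 0 y) ∧
          ∑ y ∈ (box d m).image (· + x), ν.real (openConn 0 y) ≤
            C * ((2 * m + 1 : ℕ) : ℝ) ^ d * oneArmProb d (criticalProbI d) m *
              ν.real {ω | ∃ q ∈ (box d m).image (· + x), ω ∈ (openConn (0 : Site d) q : Set (BondConfig (Site d)))} := by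
  have hd1 : 1 ≤ d := le_trans (by norm_num) hd
  have hp : 0 < ((criticalProbI d : unitInterval) : ℝ) := by
    rw [coe_criticalProbI]; exact criticalProb_zd_pos d hd1
  have hπ : ∀ m : ℕ, 0 < oneArmProb d (criticalProbI d) m := fun m => oneArmProb_pos hd1 _ hp m
  obtain ⟨cN, CN, hcN, hCN, hN⟩ := exists_iicMeasure_real_exists_openConn_ball_two_sided_criticalProbI hd hs hsL hϰ hA2 hl hcU hCU
  obtain ⟨n₀, cS, CS, hn₀, hcS, hCS, hS⟩ := exists_iicMeasure_sum_ball_real_openConn_two_sided_criticalProbI hd hs hsL hϰ hA2 hl hcU hCU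
  refine ⟨2 * n₀, cS / CN, CS / cN, by omega, by positivity, by positivity, fun ν _ hν m x hm hlx hn₀x => ?_⟩
  set n := Site.supNorm x with hn
  set M : ℝ := ((2 * m + 1 : ℕ) : ℝ) ^ d with hM
  set H := ν.real {ω | ∃ q ∈ (box d m).image (· + x), ω ∈ (openConn (0 : Site d) q : Set (BondConfig (Site d)))} with hH
  have h2m : 2 * m ≤ n := le_trans (by nlinarith) hlx
  obtain ⟨hN1, hN2⟩ := hN ν hν m x hm hlx
  obtain ⟨hS1, hS2⟩ := hS ν hν m x h2m hn₀x
  have hM0 : 0 ≤ M := by positivity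
  refine ⟨?_, ?_⟩
  · -- `(cS/CN)·M·π(m)·H ≤ (cS/CN)·M·CN π(n)... = cS M π(n) ≤ Σ`
    calc cS / CN * M * oneArmProb d (criticalProbI d) m * H = cS / CN * M * (oneArmProb d (criticalProbI d) m * H) := by ring
      _ ≤ cS / CN * M * (CN * oneArmProb d (criticalProbI d) n) := mul_le_mul_of_nonneg_left hN2 (by positivity)
      _ = cS * M * oneArmProb d (criticalProbI d) n := by field_simp
      _ ≤ _ := hS1
  · calc ∑ y ∈ (box d m).image (· + x), ν.real (openConn 0 y) ≤ CS * M * oneArmProb d (criticalProbI d) n := hS2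
      _ = CS / cN * M * (cN * oneArmProb d (criticalProbI d) n) := by field_simp
      _ ≤ CS / cN * M * (oneArmProb d (criticalProbI d) m * H) := mul_le_mul_of_nonneg_left hN1 (by positivity)
      _ = CS / cN * M * oneArmProb d (criticalProbI d) m * H := by ring

/-! ## §2 The second moment of the mass near a far point -/

open Classical in
/-- **THE SECOND MOMENT OF THE IIC MASS IN A FAR BALL: `Σ_{y, y' ∈ Λ_x(m)} ν(0 ↔ y, 0 ↔ y') ≤ C·M²·π_{p_c}(m)·π_{p_c}(‖x‖)`** (`p_c(ℤ^d)`,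
`d ≥ 2`; (A2)□ at aspect `(s,L)`, `2 ≤ s ≤ L`, `ϰ > 0`; `CU⁺_l(c_U)`, `l ≥ 2`, `c_U > 0`; `M = (2m+1)^d`): there are `n₀ ≥ 1` and `C > 0`
such that the bound holds for every IIC probability measure `ν`, every `m ≥ 1` and every `x` with `4m ≤ ‖x‖_∞`, `n₀ ≤ ‖x‖_∞`.  Proof: the
diagonal terms are `ν(0 ↔ y) ≤ C·π(‖y‖)` (`…IICTwoPointCU`); for `y ≠ y'` the threshold-free pair bound of `…IICSpanningTree` along the
nearest-parent insertion `0, y, y'` (`‖y' − y‖ ≤ 2m < ‖y'‖`) gives `ν(0 ↔ y, 0 ↔ y') ≤ C²·π(‖y‖)·π(‖y' − y‖)`; then `π(‖y‖) ≤ B·π(‖x‖)`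
(ratio bound), `Σ_{y' ≠ y} π(‖y' − y‖) ≤ Σ_{w ∈ Λ(2m)} π(‖w‖) ≤ C_b·(2m)^d·π(2m)` (one-arm ball sum) and `1 ≤ M·π(m)/c₁` (BK floor).
[cite: Kesten1986, Thm. (8)] [cite: BasuSapozhnikov2017ECP, Thm. 1.1 and Remark 2.1] -/
theorem exists_iicMeasure_sum_ball_sum_ball_real_openConn_inter_le_criticalProbI (hd : 2 ≤ d) {s L : ℕ} (hs : 2 ≤ s)
    (hsL : s ≤ L) {ϰ : ℝ} (hϰ : 0 < ϰ) (hA2 : SetToSetQuasiMultAspectAt d (criticalProbI d) s L ϰ) {l : ℕ} (hl : 2 ≤ l)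
    {cU : ℝ} (hcU : 0 < cU)
    (hCU : ∀ a : ℕ, 1 ≤ a → ∀ E : Set (BondConfig (Site d)), IsUpperSet E → MeasurableSet E →
      cU * (bondPercolation (zdGraph d) (criticalProbI d)).real E ≤ (bondPercolation (zdGraph d) (criticalProbI d)).real (E ∩
        {ω : BondConfig (Site d) | ∀ t ∈ innerBoundary (zdGraph d) (box d a), ∀ s ∈ innerBoundary (zdGraph d) (box d (l * a)),
          ∀ t' ∈ innerBoundary (zdGraph d) (box d a), ∀ s' ∈ innerBoundary (zdGraph d) (box d (l * a)),
          ω ∈ openConnIn (↑((box d (l * a) \ box d a) ∪ innerBoundary (zdGraph d) (box d a)) : Set (Site d)) t s →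
          ω ∈ openConnIn (↑((box d (l * a) \ box d a) ∪ innerBoundary (zdGraph d) (box d a)) : Set (Site d)) t' s' →
          ω ∈ openConnIn (↑((box d (l * a) \ box d a) ∪ innerBoundary (zdGraph d) (box d a)) : Set (Site d)) s s'})) :
    ∃ (n₀ : ℕ) (C : ℝ), 1 ≤ n₀ ∧ 0 < C ∧ ∀ (ν : Measure (BondConfig (Site d))) [IsProbabilityMeasure ν],
      (∀ (F : Finset (Sym2 (Site d))) (E : Set (BondConfig (Site d))), MeasurableSet E → DeterminedBy E ↑F →
        Tendsto (fun n : ℕ => (bondPercolation (zdGraph d) (criticalProbI d)).real (E ∩ siteToBoundary d n) /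
          oneArmProb d (criticalProbI d) n) atTop (𝓝 (ν.real E))) →
      ∀ (m : ℕ) (x : Site d), 1 ≤ m → 4 * m ≤ Site.supNorm x → n₀ ≤ Site.supNorm x →
        ∑ y ∈ (box d m).image (· + x), ∑ y' ∈ (box d m).image (· + x),
            ν.real ((openConn (0 : Site d) y : Set (BondConfig (Site d))) ∩ openConn (0 : Site d) y') ≤
          C * (((2 * m + 1 : ℕ) : ℝ) ^ d) ^ 2 * oneArmProb d (criticalProbI d) m * oneArmProb d (criticalProbI d) (Site.supNorm x) := by
  have hd1 : 1 ≤ d := le_trans (by norm_num) hd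
  have hd0 : (0 : ℝ) < d := by exact_mod_cast (lt_of_lt_of_le (by norm_num : 0 < 2) hd)
  have hp : 0 < ((criticalProbI d : unitInterval) : ℝ) := by
    rw [coe_criticalProbI]; exact criticalProb_zd_pos d hd1
  have hπ : ∀ m : ℕ, 0 < oneArmProb d (criticalProbI d) m := fun m => oneArmProb_pos hd1 _ hp m
  obtain ⟨n₀, cP, CP, hn₀, hcP, hCP, hP⟩ := exists_iicMeasure_real_openConn_two_sided_noDecay_criticalProbI hd hs hsL hϰ hA2 hl hcU hCU
  obtain ⟨B, hB, hR⟩ := Rsw3.exists_oneArmProb_ratio_of_setToSetQuasiMultAspectAt hd hs hsL hϰ hA2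
  obtain ⟨CT, hCT, hT⟩ := exists_iicMeasure_real_biInter_openConn_le_pow_mul_prod_nearest_all_criticalProbI hd hs hsL hϰ hA2 hl hcU hCU
  obtain ⟨Cb, hCb, hball⟩ := exists_sum_box_oneArmProb_supNorm_le_criticalProbI hd hs hsL hϰ hA2
  obtain ⟨c₁, hc₁, hfloor⟩ := exists_oneArmProb_criticalProbI_lower_half (d := d) hd
  have hB1 : 1 ≤ B := by
    have h := hR 1 1 le_rfl le_rfl (by norm_num)
    nlinarith [hπ 1]
  refine ⟨2 * n₀, B * (CP / c₁ + CT ^ 2 * (Cb * 2 ^ d)), by omega, by positivity, fun ν _ hν m x hm h4m hn₀x => ?_⟩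
  set n := Site.supNorm x with hn
  set M : ℝ := ((2 * m + 1 : ℕ) : ℝ) ^ d with hM
  set T := (box d m).image (· + x) with hTdef
  set π : ℕ → ℝ := fun k => oneArmProb d (criticalProbI d) k with hπdef
  have hM0 : 0 < M := by positivity
  have hm0 : (0 : ℝ) < m := by exact_mod_cast hm
  -- geometry of the translated ball
  have hnorm : ∀ y ∈ T, n - m ≤ Site.supNorm y ∧ Site.supNorm y ≤ n + m := by
    intro y hy
    obtain ⟨w, hw, rfl⟩ := Finset.mem_image.1 hy
    have h1 := mem_box_iff_supNorm_le.1 hw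
    have h2 : Site.supNorm (w + x) ≤ Site.supNorm w + Site.supNorm x := Site.supNorm_add_le w x
    have h3 : Site.supNorm x ≤ Site.supNorm (w + x) + Site.supNorm w := by
      have h := Site.supNorm_add_le (w + x) (-w)
      rwa [Site.supNorm_neg, add_neg_cancel_comm] at h
    constructor <;> omega
  have hdiff : ∀ y ∈ T, ∀ y' ∈ T, Site.supNorm (y' - y) ≤ 2 * m := by
    intro y hy y' hy'
    obtain ⟨w, hw, rfl⟩ := Finset.mem_image.1 hy
    obtain ⟨w', hw', rfl⟩ := Finset.mem_image.1 hy'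
    have h1 := mem_box_iff_supNorm_le.1 hw
    have h2 := mem_box_iff_supNorm_le.1 hw'
    have h3 : w' + x - (w + x) = w' + -w := by abel
    have h4 : Site.supNorm (w' + -w) ≤ Site.supNorm w' + Site.supNorm (-w) := Site.supNorm_add_le w' (-w)
    rw [Site.supNorm_neg] at h4
    rw [h3]; omega
  have hcardT : (T.card : ℝ) = M := by
    have hinj : Set.InjOn (fun w : Site d => w + x) ↑(box d m) := fun a _ b _ h => add_right_cancel h
    rw [hTdef, Finset.card_image_of_injOn hinj, card_box]; push_cast; rw [hM]; push_cast; ring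
  -- the ratio bound `π(‖y‖) ≤ B π(n)` for `y ∈ T`
  have hratio : ∀ y ∈ T, π (Site.supNorm y) ≤ B * π n := by
    intro y hy
    obtain ⟨h1, h2⟩ := hnorm y hy
    by_cases hyn : Site.supNorm y ≤ n
    · exact hR _ _ (by omega) hyn (by omega)
    · calc π (Site.supNorm y) ≤ π n := real_siteToBoundary_antitone _ (by omega)
        _ ≤ B * π n := le_mul_of_one_le_left (hπ n).le hB1
  -- `1 ≤ M π(m)/c₁`
  have hMπ : c₁ ≤ M * π m := by
    have h := hfloor m hm
    have hpos : 0 < (m : ℝ) ^ (((d : ℝ) - 1) / 2) := Real.rpow_pos_of_pos hm0 _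
    rw [div_le_iff₀ hpos] at h
    have hexp : (m : ℝ) ^ (((d : ℝ) - 1) / 2) ≤ M := by
      have h1 : (1 : ℝ) ≤ m := by exact_mod_cast hm
      calc (m : ℝ) ^ (((d : ℝ) - 1) / 2) ≤ (m : ℝ) ^ (d : ℝ) := Real.rpow_le_rpow_of_exponent_le h1 (by linarith [hd0])
        _ = (m : ℝ) ^ d := Real.rpow_natCast _ _
        _ ≤ M := by
            rw [hM]; push_cast
            exact pow_le_pow_left₀ hm0.le (by linarith) d
    calc c₁ ≤ oneArmProb d (criticalProbI d) m * (m : ℝ) ^ (((d : ℝ) - 1) / 2) := h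
      _ ≤ π m * M := mul_le_mul_of_nonneg_left hexp (hπ m).le
      _ = M * π m := mul_comm _ _
  -- the one-arm ball sum over `Λ(2m)`: `≤ Cb (2m)^d π(2m) ≤ Cb 2^d M π(m)`
  have hballsum : ∑ w ∈ box d (2 * m), π (Site.supNorm w) ≤ Cb * 2 ^ d * M * π m := by
    have h := hball (2 * m) (by omega)
    have h2 : ((2 * m : ℕ) : ℝ) ^ d ≤ 2 ^ d * M := by
      rw [hM, ← mul_pow]; push_cast
      exact pow_le_pow_left₀ (by positivity) (by linarith) d
    have h3 : π (2 * m) ≤ π m := real_siteToBoundary_antitone _ (by omega)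
    calc ∑ w ∈ box d (2 * m), π (Site.supNorm w) ≤ Cb * ((2 * m : ℕ) : ℝ) ^ d * oneArmProb d (criticalProbI d) (2 * m) := h
      _ ≤ Cb * (2 ^ d * M) * π m := mul_le_mul (mul_le_mul_of_nonneg_left h2 hCb.le) h3 (hπ _).le (by positivity)
      _ = Cb * 2 ^ d * M * π m := by ring
  -- the off-diagonal pair bound
  have hpair : ∀ y ∈ T, ∀ y' ∈ T, y' ≠ y →
      ν.real ((openConn (0 : Site d) y : Set (BondConfig (Site d))) ∩ openConn (0 : Site d) y') ≤
        CT ^ 2 * (π (Site.supNorm y) * π (Site.supNorm (y' - y))) := by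
    intro y hy y' hy' hne
    obtain ⟨hy1, hy2⟩ := hnorm y hy
    obtain ⟨hy1', hy2'⟩ := hnorm y' hy'
    have hdy := hdiff y hy y' hy'
    have hne' : 1 ≤ Site.supNorm (y' - y) := by
      rcases Nat.eq_zero_or_pos (Site.supNorm (y' - y)) with h0 | h0
      · exact absurd (sub_eq_zero.1 (Site.supNorm_eq_zero_iff.1 h0)) hne
      · exact h0
    set z : ℕ → Site d := fun i => if i = 1 then y else if i = 2 then y' else 0 with hz
    set par : ℕ → ℕ := fun i => if i = 2 then 1 else 0 with hpar
    have hz0 : z 0 = 0 := by simp [hz]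
    have hz1 : z 1 = y := by simp [hz]
    have hz2 : z 2 = y' := by simp [hz]
    have hp1 : par 1 = 0 := by simp [hpar]
    have hp2 : par 2 = 1 := by simp [hpar]
    have h := hT ν hν 2 z par hz0
      (by intro i hi1 hi2; interval_cases i <;> simp [hpar])
      (by
        intro i hi1 hi2
        interval_cases i
        · rw [hp1, hz1, hz0, sub_zero]; omega
        · rw [hp2, hz2, hz1]; exact hne')
      (by
        intro i hi1 hi2 j hj
        interval_cases i
        · interval_cases j; rw [hp1]
        · rw [hp2, hz2, hz1]
          interval_cases j
          · rw [hz0, sub_zero]; omega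
          · rw [hz1])
    have hIcc : Finset.Icc 1 2 = ({1, 2} : Finset ℕ) := by
      ext i; simp only [Finset.mem_Icc, Finset.mem_insert, Finset.mem_singleton]; omega
    rw [hIcc, Finset.prod_insert (by simp), Finset.prod_singleton, hp1, hp2, hz1, hz2, hz0, sub_zero] at h
    have hsub : (openConn (0 : Site d) y : Set (BondConfig (Site d))) ∩ openConn (0 : Site d) y' ⊆
        ⋂ i ∈ ({1, 2} : Finset ℕ), (openConn (0 : Site d) (z i) : Set (BondConfig (Site d))) := by
      intro ω hω
      simp only [Finset.mem_insert, Finset.mem_singleton, Set.mem_iInter]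
      rintro i (rfl | rfl)
      · rw [hz1]; exact hω.1
      · rw [hz2]; exact hω.2
    exact (measureReal_mono hsub (measure_ne_top _ _)).trans h
  -- the inner sum for a fixed `y`
  have hinner : ∀ y ∈ T, ∑ y' ∈ T, ν.real ((openConn (0 : Site d) y : Set (BondConfig (Site d))) ∩ openConn (0 : Site d) y') ≤
      B * (CP / c₁ + CT ^ 2 * (Cb * 2 ^ d)) * M * π m * π n := by
    intro y hy
    obtain ⟨hy1, hy2⟩ := hnorm y hy
    -- diagonal
    have hdiag : ν.real ((openConn (0 : Site d) y : Set (BondConfig (Site d))) ∩ openConn (0 : Site d) y) ≤ CP * (B * π n) := by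
      rw [Set.inter_self]
      have h := (hP ν hν (Site.supNorm y) y (by omega) (mem_sphere.2 rfl)).2
      exact h.trans (mul_le_mul_of_nonneg_left (hratio y hy) hCP.le)
    -- off-diagonal sum
    have hoff : ∑ y' ∈ T.erase y, ν.real ((openConn (0 : Site d) y : Set (BondConfig (Site d))) ∩ openConn (0 : Site d) y') ≤
        CT ^ 2 * (B * π n) * (Cb * 2 ^ d * M * π m) := by
      have h1 : ∑ y' ∈ T.erase y, ν.real ((openConn (0 : Site d) y : Set (BondConfig (Site d))) ∩ openConn (0 : Site d) y') ≤
          ∑ y' ∈ T.erase y, CT ^ 2 * (π (Site.supNorm y) * π (Site.supNorm (y' - y))) :=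
        Finset.sum_le_sum fun y' hy' => hpair y hy y' (Finset.mem_of_mem_erase hy') (Finset.ne_of_mem_erase hy')
      have h2 : ∑ y' ∈ T.erase y, π (Site.supNorm (y' - y)) ≤ ∑ w ∈ box d (2 * m), π (Site.supNorm w) := by
        have hinj : Set.InjOn (fun y' : Site d => y' - y) ↑(T.erase y) := fun a _ b _ h => sub_left_injective h
        rw [← Finset.sum_image (f := fun w => π (Site.supNorm w)) hinj]
        refine Finset.sum_le_sum_of_subset_of_nonneg ?_ fun w _ _ => (hπ _).le
        intro w hw
        obtain ⟨y', hy', rfl⟩ := Finset.mem_image.1 hw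
        exact mem_box_iff_supNorm_le.2 (hdiff y hy y' (Finset.mem_of_mem_erase hy'))
      calc ∑ y' ∈ T.erase y, ν.real ((openConn (0 : Site d) y : Set (BondConfig (Site d))) ∩ openConn (0 : Site d) y')
          ≤ ∑ y' ∈ T.erase y, CT ^ 2 * (π (Site.supNorm y) * π (Site.supNorm (y' - y))) := h1
        _ = CT ^ 2 * π (Site.supNorm y) * ∑ y' ∈ T.erase y, π (Site.supNorm (y' - y)) := by
            rw [Finset.mul_sum]; exact Finset.sum_congr rfl fun _ _ => by ring
        _ ≤ CT ^ 2 * (B * π n) * (Cb * 2 ^ d * M * π m) := by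
            have hπn := hπ n
            exact mul_le_mul (mul_le_mul_of_nonneg_left (hratio y hy) (by positivity)) (h2.trans hballsum)
              (Finset.sum_nonneg fun _ _ => (hπ _).le) (by positivity)
    rw [← Finset.add_sum_erase T _ hy]
    have hCP' : CP * (B * π n) ≤ CP / c₁ * (B * π n) * (M * π m) := by
      rw [show CP / c₁ * (B * π n) * (M * π m) = CP * (B * π n) * ((M * π m) / c₁) by ring]
      have hπn := hπ n
      exact le_mul_of_one_le_right (by positivity) ((one_le_div hc₁).2 hMπ)
    calc ν.real ((openConn (0 : Site d) y : Set (BondConfig (Site d))) ∩ openConn (0 : Site d) y) +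
          ∑ y' ∈ T.erase y, ν.real ((openConn (0 : Site d) y : Set (BondConfig (Site d))) ∩ openConn (0 : Site d) y')
        ≤ CP / c₁ * (B * π n) * (M * π m) + CT ^ 2 * (B * π n) * (Cb * 2 ^ d * M * π m) := add_le_add (hdiag.trans hCP') hoff
      _ = B * (CP / c₁ + CT ^ 2 * (Cb * 2 ^ d)) * M * π m * π n := by ring
  calc ∑ y ∈ T, ∑ y' ∈ T, ν.real ((openConn (0 : Site d) y : Set (BondConfig (Site d))) ∩ openConn (0 : Site d) y')
      ≤ ∑ _y ∈ T, B * (CP / c₁ + CT ^ 2 * (Cb * 2 ^ d)) * M * π m * π n := Finset.sum_le_sum hinner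
    _ = B * (CP / c₁ + CT ^ 2 * (Cb * 2 ^ d)) * M ^ 2 * π m * π n := by
        rw [Finset.sum_const, nsmul_eq_mul, hcardT]; ring

/-! ## §3 Markov: the conditional mass is tight -/

open Classical in
/-- **THE MASS IN A VISITED FAR BALL IS TIGHT AT THE SCALE `m^d π(m)`** (`p_c(ℤ^d)`, `d ≥ 2`; (A2)□(s,L) + `CU⁺_l`): there are `n₀ ≥ 1` and
`C > 0` such that for every IIC probability measure `ν`, every `m`, every `x` with `2m ≤ ‖x‖_∞`, `n₀ ≤ ‖x‖_∞`, and every `K ≥ 0`: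
**`K·π_{p_c}(m)·ν(#{y ∈ Λ_x(m) : 0 ↔ y} ≥ K·(2m+1)^d·π_{p_c}(m)) ≤ C·π_{p_c}(‖x‖)`** (Markov and `E_ν[#] ≤ C·M·π(‖x‖)`, `…IICTwoPointCU`);
with `ν(hit) ≍ π(‖x‖)/π(m)`: given the hit, `#/(M·π(m)) ≥ K` has conditional probability `≤ C'/K`. [cite: Kesten1986, Thm. (8)] -/
theorem exists_iicMeasure_real_card_ball_ge_le_criticalProbI (hd : 2 ≤ d) {s L : ℕ} (hs : 2 ≤ s) (hsL : s ≤ L)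
    {ϰ : ℝ} (hϰ : 0 < ϰ) (hA2 : SetToSetQuasiMultAspectAt d (criticalProbI d) s L ϰ) {l : ℕ} (hl : 2 ≤ l) {cU : ℝ} (hcU : 0 < cU)
    (hCU : ∀ a : ℕ, 1 ≤ a → ∀ E : Set (BondConfig (Site d)), IsUpperSet E → MeasurableSet E →
      cU * (bondPercolation (zdGraph d) (criticalProbI d)).real E ≤ (bondPercolation (zdGraph d) (criticalProbI d)).real (E ∩
        {ω : BondConfig (Site d) | ∀ t ∈ innerBoundary (zdGraph d) (box d a), ∀ s ∈ innerBoundary (zdGraph d) (box d (l * a)),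
          ∀ t' ∈ innerBoundary (zdGraph d) (box d a), ∀ s' ∈ innerBoundary (zdGraph d) (box d (l * a)),
          ω ∈ openConnIn (↑((box d (l * a) \ box d a) ∪ innerBoundary (zdGraph d) (box d a)) : Set (Site d)) t s →
          ω ∈ openConnIn (↑((box d (l * a) \ box d a) ∪ innerBoundary (zdGraph d) (box d a)) : Set (Site d)) t' s' →
          ω ∈ openConnIn (↑((box d (l * a) \ box d a) ∪ innerBoundary (zdGraph d) (box d a)) : Set (Site d)) s s'})) :
    ∃ (n₀ : ℕ) (C : ℝ), 1 ≤ n₀ ∧ 0 < C ∧ ∀ (ν : Measure (BondConfig (Site d))) [IsProbabilityMeasure ν],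
      (∀ (F : Finset (Sym2 (Site d))) (E : Set (BondConfig (Site d))), MeasurableSet E → DeterminedBy E ↑F →
        Tendsto (fun n : ℕ => (bondPercolation (zdGraph d) (criticalProbI d)).real (E ∩ siteToBoundary d n) /
          oneArmProb d (criticalProbI d) n) atTop (𝓝 (ν.real E))) →
      ∀ (m : ℕ) (x : Site d) (K : ℝ), 2 * m ≤ Site.supNorm x → n₀ ≤ Site.supNorm x → 0 ≤ K →
        K * oneArmProb d (criticalProbI d) m *
            ν.real {ω | K * ((2 * m + 1 : ℕ) : ℝ) ^ d * oneArmProb d (criticalProbI d) m ≤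
              ((((box d m).image (· + x)).filter fun y => ω ∈ (openConn (0 : Site d) y : Set (BondConfig (Site d)))).card : ℝ)} ≤
          C * oneArmProb d (criticalProbI d) (Site.supNorm x) := by
  have hd1 : 1 ≤ d := le_trans (by norm_num) hd
  obtain ⟨n₀, cS, CS, hn₀, hcS, hCS, hS⟩ := exists_iicMeasure_sum_ball_real_openConn_two_sided_criticalProbI hd hs hsL hϰ hA2 hl hcU hCU
  refine ⟨2 * n₀, CS, by omega, hCS, fun ν _ hν m x K h2m hn₀x hK => ?_⟩
  set M : ℝ := ((2 * m + 1 : ℕ) : ℝ) ^ d with hM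
  set T := (box d m).image (· + x) with hTdef
  have hM0 : 0 < M := by positivity
  obtain ⟨-, hS2⟩ := hS ν hν m x h2m hn₀x
  have hMarkov := Rsw3.mul_real_le_card_filter_le_sum ν T (fun y => (openConn (0 : Site d) y : Set (BondConfig (Site d))))
    (fun y _ => measurableSet_openConn_holds 0 y) (K * M * oneArmProb d (criticalProbI d) m)
  have h := hMarkov.trans hS2
  -- `K M π(m) ν{…} ≤ CS M π(n)`; divide by `M`
  have h' : K * oneArmProb d (criticalProbI d) m *
      ν.real {ω | K * M * oneArmProb d (criticalProbI d) m ≤ ((T.filter fun y => ω ∈ (openConn (0 : Site d) y : Set (BondConfig (Site d)))).card : ℝ)} * M ≤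
      CS * oneArmProb d (criticalProbI d) (Site.supNorm x) * M := by
    calc K * oneArmProb d (criticalProbI d) m *
          ν.real {ω | K * M * oneArmProb d (criticalProbI d) m ≤ ((T.filter fun y => ω ∈ (openConn (0 : Site d) y : Set (BondConfig (Site d)))).card : ℝ)} * M
        = K * M * oneArmProb d (criticalProbI d) m *
          ν.real {ω | K * M * oneArmProb d (criticalProbI d) m ≤ ((T.filter fun y => ω ∈ (openConn (0 : Site d) y : Set (BondConfig (Site d)))).card : ℝ)} := by
          ring
      _ ≤ CS * M * oneArmProb d (criticalProbI d) (Site.supNorm x) := h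
      _ = CS * oneArmProb d (criticalProbI d) (Site.supNorm x) * M := by ring
  exact le_of_mul_le_mul_right h' hM0

end Summit.CriticalPhenomena.PercolationContinuityZ3.Theorems.Crossing

end
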